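import Summits.BirchSwinnertonDyer.BirchSwinnertonDyer.Theorems.Rank2ObservatoryRank3SatCensusA
import Summits.BirchSwinnertonDyer.BirchSwinnertonDyer.Theorems.Rank2ObservatoryRank3SatCensusB
import Summits.BirchSwinnertonDyer.BirchSwinnertonDyer.Theorems.Rank2ObservatoryRank3CensusResidual
import Summits.BirchSwinnertonDyer.BirchSwinnertonDyer.Theorems.Rank2ObservatoryRank3SatRowsS01
import HarnessLib

/-!
# BirchSwinnertonDyer — rank ≥ 2 observatory: the rank-3 SATURATION CENSUS (residual-free)

HONEST FRAMING: per-curve certified theorems and census instruments; no claim on BSD in rank ≥ 2.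

The table-level statements of the rank-3 saturation instrument (generic layer
`Rank2ObservatoryListedSpan` / `…Rank3SatCertB` / `…Rank3SatCert` / `…Rank3SatCertT` /
`…Rank3SatCertS`; data `…Rank3SatRowsNNx` (81 files, 170 windows), `…Rank3SatRowsT01/T02`
(22 windows) and `…Rank3SatRowsS01` (the 30 torsion-supplement rows U/V/W, 2 windows), one kernel
`decide` each; chunk covers `…Rank3SatCensusA/B`) — RESIDUAL-FREE:

* `SatCensus.cover` — every row of the census table `rank3Table` (9 487 curves of rank 3 and
  conductor `< 500 000`) is covered by a base / variant-T window or is one of the 30 listed rows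
  `satSkippedRows` (the chunk covers glued);
* **`SatCensus.twoSaturated_of_mem_rank3Table`** — for EVERY row of `rank3Table` (no exception):
  the listed generators `P₁, P₂, P₃` are `ℤ`-independent and span, with `E(ℚ)_tors`, a
  `2`-SATURATED subgroup of `E(ℚ)` (the cover, and
  `Rank3SatRowsS01.twoSaturated_of_mem_satSkippedRows` for the 30 listed rows);
* **`SatCensus.finiteIndex_and_odd_index_of_mem_rows`** — the JOIN with the GRAND rank census
  `Rank2ObservatoryRank3KernelRankCensusN9365` (`rank_ℤ E(ℚ) = 3`, hypothesis-free, 9 365 rows):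
  for EVERY GRAND-census row the listed span `ℤP₁ + ℤP₂ + ℤP₃ + E(ℚ)_tors` has FINITE and ODD
  index in `E(ℚ)` — equivalently `Reg(P₁, P₂, P₃) = n² · Reg(E(ℚ)/tors)` with `n` odd (the first
  kernel statement of this observatory on the regulator side of the BSD formula; no claim about
  `n = 1`);
* bookkeeping without heavy kernel work: `satSkippedRows_sublist` (one walk of the table),
  `satSkippedRows_not_residual` (30 × 122 comparisons: every torsion-supplement row is also
  rank-certified), `satSkippedRows_subset_rows`.

What this is NOT: not a claim that the listed generators are a basis (index `n = 1` needs
`p`-saturation at every prime `p ≤` a height bound — not attempted here), nothing about the 122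
rank-residual rows of the table outside the GRAND census (their saturation statement above is
unconditional, their rank is not certified here), and nothing about BSD in rank `≥ 2`.

References: Cremona, *Algorithms for Modular Elliptic Curves* (1997) §3.5; Siksek, Rocky Mountain
J. Math. 25 (1995); Silverman, *The Arithmetic of Elliptic Curves* (2009) VIII.6.7.
-/

-- single-conjunct summit: `Summit.BirchSwinnertonDyer.BirchSwinnertonDyer.…` repeats the name
set_option linter.dupNamespace false

namespace Summit.BirchSwinnertonDyer.BirchSwinnertonDyer.Rank2Observatory

namespace SatCensus

open Rank3KernelRankCensusN9365 (rows mem_rank3Table rank_eq_three)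

/-- **Coverage of the whole census table** (the 27 chunk covers glued by
`List.forall_mem_append`). [cite: CremonaAlgorithms1997, §3.5] -/
theorem cover : ∀ r ∈ rank3Table,
    (∀ h : r.check = true,
        (∀ a : r.curve.toAffine.Point,
          2 • a ∈ AddSubgroup.closure {r.gen₁ h, r.gen₂ h, r.gen₃ h} ⊔ AddCommGroup.torsion _ →
            a ∈ AddSubgroup.closure {r.gen₁ h, r.gen₂ h, r.gen₃ h} ⊔ AddCommGroup.torsion _) ∧
        LinearIndependent ℤ ![r.gen₁ h, r.gen₂ h, r.gen₃ h]) ∨ r ∈ satSkippedRows := by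
  unfold rank3Table
  exact
    CensusAudit.forall_app (CensusAudit.forall_app (CensusAudit.forall_app
      (CensusAudit.forall_app (CensusAudit.forall_app (CensusAudit.forall_app
      (CensusAudit.forall_app (CensusAudit.forall_app (CensusAudit.forall_app
      (CensusAudit.forall_app (CensusAudit.forall_app (CensusAudit.forall_app
      (CensusAudit.forall_app (CensusAudit.forall_app (CensusAudit.forall_app
      (CensusAudit.forall_app (CensusAudit.forall_app (CensusAudit.forall_app
      (CensusAudit.forall_app (CensusAudit.forall_app (CensusAudit.forall_app
      (CensusAudit.forall_app (CensusAudit.forall_app (CensusAudit.forall_app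
      (CensusAudit.forall_app (CensusAudit.forall_app cover01 cover02) cover03) cover04)
      cover05) cover06) cover07) cover08) cover09) cover10) cover11) cover12) cover13)
      cover14) cover15) cover16) cover17) cover18) cover19) cover20) cover21) cover22)
      cover23) cover24) cover25) cover26) cover27

/-- **EVERY row of the census table**: `ℤ`-independent listed generators spanning, with
`E(ℚ)_tors`, a `2`-saturated subgroup of `E(ℚ)` (the cover, and the torsion-supplement certificates
of `Rank2ObservatoryRank3SatRowsS01` for the 30 listed rows).
[cite: CremonaAlgorithms1997, §3.5] -/
theorem twoSaturated_of_mem_rank3Table {r : Rank3Row} (hr : r ∈ rank3Table) (h : r.check = true) :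
    (∀ a : r.curve.toAffine.Point,
      2 • a ∈ AddSubgroup.closure {r.gen₁ h, r.gen₂ h, r.gen₃ h} ⊔ AddCommGroup.torsion _ →
        a ∈ AddSubgroup.closure {r.gen₁ h, r.gen₂ h, r.gen₃ h} ⊔ AddCommGroup.torsion _) ∧
    LinearIndependent ℤ ![r.gen₁ h, r.gen₂ h, r.gen₃ h] :=
  (cover r hr).elim (fun H => H h)
    fun hs => Rank3SatRowsS01.twoSaturated_of_mem_satSkippedRows r hs h

/-- **THE JOIN with the GRAND rank census.** For every row of
`Rank2ObservatoryRank3KernelRankCensusN9365.rows` (`rank_ℤ E(ℚ) = 3`; all 9 365 of them) the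
listed span `ℤP₁ + ℤP₂ + ℤP₃ + E(ℚ)_tors` has finite ODD index in `E(ℚ)`:
`Reg(P₁, P₂, P₃) = n² · Reg(E(ℚ)/tors)`, `n` odd.
[cite: CremonaAlgorithms1997, §3.5] [cite: SilvermanAEC2009, Thm. VIII.6.7] -/
theorem finiteIndex_and_odd_index_of_mem_rows {r : Rank3Row} (hr : r ∈ rows) (h : r.check = true) :
    (AddSubgroup.closure {r.gen₁ h, r.gen₂ h, r.gen₃ h} ⊔ AddCommGroup.torsion _).FiniteIndex ∧
      Odd (AddSubgroup.closure {r.gen₁ h, r.gen₂ h, r.gen₃ h} ⊔ AddCommGroup.torsion _).index :=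
  have h₂ := twoSaturated_of_mem_rank3Table (mem_rank3Table r hr) h
  r.finiteIndex_and_odd_index_of_twoSaturated h h₂.1 h₂.2 (rank_eq_three r hr)

/-- The same with the row-predicate proof supplied (`check_of_mem`).
[cite: CremonaAlgorithms1997, §3.5] -/
theorem finiteIndex_and_odd_index_of_mem_rows' {r : Rank3Row} (hr : r ∈ rows) :
    (AddSubgroup.closure {r.gen₁ (check_of_mem (mem_rank3Table r hr)),
        r.gen₂ (check_of_mem (mem_rank3Table r hr)), r.gen₃ (check_of_mem (mem_rank3Table r hr))} ⊔
        AddCommGroup.torsion _).FiniteIndex ∧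
      Odd (AddSubgroup.closure {r.gen₁ (check_of_mem (mem_rank3Table r hr)),
        r.gen₂ (check_of_mem (mem_rank3Table r hr)), r.gen₃ (check_of_mem (mem_rank3Table r hr))} ⊔
        AddCommGroup.torsion _).index :=
  finiteIndex_and_odd_index_of_mem_rows hr _

/-! ### Bookkeeping: the torsion-supplement rows inside the table and the GRAND census -/

/-- The 30 torsion-supplement rows form a sublist of the census table (ONE walk of the table in the kernel).
[cite: CremonaAlgorithms1997, Tables] -/
theorem satSkippedRows_sublist : satSkippedRows.Sublist rank3Table := by
  decide +kernel

/-- The torsion-supplement rows are table rows. [folklore] -/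
theorem satSkippedRows_subset : ∀ r ∈ satSkippedRows, r ∈ rank3Table :=
  fun _ hr => satSkippedRows_sublist.subset hr

/-- The torsion-supplement rows are pairwise distinct. [folklore] -/
theorem satSkippedRows_nodup : satSkippedRows.Nodup :=
  satSkippedRows_sublist.nodup rank3Table_nodup

/-- No torsion-supplement row is a rank-residual row (30 × 122 row comparisons in the kernel):
every one of them is rank-certified. [folklore] -/
theorem satSkippedRows_not_residual : ∀ r ∈ satSkippedRows, r ∉ Rank3CensusAudit.residualRows := by
  decide +kernel

/-- The torsion-supplement rows are GRAND-census rows (`Rank3CensusAudit.mem_rows_iff`).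
[folklore] -/
theorem satSkippedRows_subset_rows : ∀ r ∈ satSkippedRows, r ∈ rows :=
  fun r hr => Rank3CensusAudit.mem_rows_iff.2 ⟨satSkippedRows_subset r hr,
    satSkippedRows_not_residual r hr⟩

end SatCensus

end Summit.BirchSwinnertonDyer.BirchSwinnertonDyer.Rank2Observatory
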